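import Literature.MathematicalPhysics.QuantumLattice.TwistedTorusOneFormGap
import HarnessLib

/-!
# Second variation of the Wilson plaquette action at a (centre-)flat plaquette
# `d²/dt²|₀ Re tr(z̄·hol(e^{tX}Γ)) = −S(∇⁺_μX_ν − ∇⁺_νX_μ)`, and the twisted torus ∕ slab assembly:
# the Hessian of the Wilson action at the twist eater IS the quadratic form of `TwistedTorusOneFormGap`

Topic `Literature/MathematicalPhysics/QuantumLattice`; sequel of `TwistedTorusOneFormGap.lean` (the tree-level
quadratic forms `Σ S(∂_μ a_ν − ∂_ν a_μ)` of the twisted torus ∕ slab and their sharp Coulomb-gauge gap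
`4 sin²(π/(Nℓ))`) and companion of `Literature.MathematicalPhysics.QuantumFieldTheory.LatticeYangMillsBakryEmery`
(`wilsonPlaquetteSumAlong`, `WilsonHessianBound`: the Hessian of the Wilson plaquette sum along `e^{tX}U` as
`iteratedDeriv 2 … 0`; same LEFT perturbation and link order `U₁U₂U₃ᴴU₄ᴴ` here).  Everything stated is PROVED;
the `def`s have bodies; no named facts.

WHAT IS HERE
* §1 `word B₀ V₁ B₁ V₂ B₂ V₃ B₃ V₄ B₄ t = B₀e^{tV₁}B₁e^{tV₂}B₂e^{tV₃}B₃e^{tV₄}B₄` (matrix exponential) and its product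
  rule `hasDerivAt_word` («derivative = inserting the matrix», [SZZ] Lemma 4.1 proof), `hasDerivAt_re_trace_word`.
* §2 the pure word `expWord4 Y t = e^{tY₁}e^{tY₂}e^{tY₃}e^{tY₄}`: `hasDerivAt_re_trace_expWord4` (all `t`),
  `firstVar_zero` (`d/dt|₀ Re tr = Re tr ΣY`), ★ `hasDerivAt_firstVar_zero` ∕ `iteratedDeriv_two_re_trace_expWord4`
  (`d²/dt²|₀ Re tr = Re tr (ΣY)²`: the 16 ordered insertions, cyclicity of the trace).
* §3 skew-Hermitian directions: `re_trace_eq_zero_of_skew`, `re_trace_sq_of_skew` (`Re tr Z² = −S(Z)`,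
  `S(Z) = Re tr(ZᴴZ)`), ★ `iteratedDeriv_two_re_trace_expWord4_of_skew` (`= −S(ΣY)`), first variation `0`.
* §4 ★★ the CENTRE-FLAT plaquette [GPGAO17 §2.3 (2.3)]: links `e^{tX_i}Γ_i`, `Γ_i` unitary, `Γ₁Γ₂Γ₃ᴴΓ₄ᴴ = z·1`,
  `|z| = 1`: `plaqHol_eq_smul_expWord4` ∕ `star_smul_plaqHol_eq_expWord4` — TRANSPORT to the base point,
  `z̄·hol(t) = e^{tX₁}e^{tΓ₁X₂Γ₁ᴴ}e^{−tΓ₄X₃Γ₄ᴴ}e^{−tX₄}` («`A'_ν(n+μ̂) = Γ_μ(n)A_ν(n+μ̂)Γ_μ†(n)`»);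
  ★★ `iteratedDeriv_two_re_trace_plaqHol`: `d²/dt²|₀ Re tr(z̄·hol) = −S(X₁ + Γ₁X₂Γ₁ᴴ − Γ₄X₃Γ₄ᴴ − X₄)` = minus the
  squared norm of the background-covariant linearised field strength `∇⁺_μX_ν − ∇⁺_νX_μ`
  («`G_{μν}(n) = ∇⁺_μA_ν(n) − ∇⁺_νA_μ(n) + O(g)`»); `deriv … 0 = 0`; value `|n|` at `0`.  Unit background:
  `plaqHol_one`, `hasDerivAt_plaqTerm`, `firstVar_zero_of_skew`, `hasDerivAt_neg_firstVar_zero_of_skew`.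
* §5 ASSEMBLY in the transition-function picture of `TwistedTorusOneFormGap` (background links `1`, twist in the
  boundary condition; `a_μ : ℕ² → M_N(ℂ)` resp. `ℕ³ → M_N(ℂ)` skew-Hermitian): `windowWilsonAction a₀ a₁ ℓ t =
  Σ_{x,y<ℓ}(N − Re tr U₀(x,y)U₁(x+1,y)U₀(x,y+1)ᴴU₁(x,y)ᴴ)` with `U_μ = e^{t a_μ}`; `… _zero` (`W(0)=0`),
  `deriv_windowWilsonAction_zero` (`W'(0)=0`), ★★ `iteratedDeriv_two_windowWilsonAction`:
  `W''(0) = Σ S((a₁(x+1,y) − a₁(x,y)) − (a₀(x,y+1) − a₀(x,y)))` — LITERALLY the right-hand side of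
  `twistedTorus_oneForm_gap_of_div_eq_zero`; hence ★★ `windowWilsonAction_hessian_gap`:
  `W''(0) ≥ 4 sin²(π/(Nℓ))·Σ(S(a₀)+S(a₁))` on traceless Coulomb-gauge fluctuations around the twist eater;
  the SLAB `ℓ × ℓ × L`: `slabWindowWilsonAction`, `iteratedDeriv_two_slabWindowWilsonAction`,
  ★★ `slabWindowWilsonAction_hessian_gap` (constant UNIFORM in `L`, via `twistedSlab_oneForm_gap_of_div_eq_zero`).

SCOPE ∕ HONEST FRAMING.  Tree-level statements about ONE box: the second variation of the Wilson action at the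
twist-eating zero-action configuration along a line `t ↦ e^{t a}`, and its gap modulo gauge.  Nothing here about
the joint second-order expansion in all of `𝔰𝔲(N)^E` with remainder (for that combine §4 per plaquette with
`Literature.Analysis.Asymptotics.isLittleO_taylor_two`), interacting corrections, `β`-uniformity, semiclassical
transfer-operator asymptotics, vacuum dominance (anchor T1 of `twisted-slab-continuity`: 0∕1), `IRcof`∕`IR`, or
the Yang–Mills mass gap (Clay), which is NOT proved; `R4` closes only `BalabanLadder.UV`.  Summit-side analogue
(not importable here, different statement: a BOUND `|W''| ≤ 4d‖X‖²` at every configuration):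
`Summits/Ventures/YMGap/Thresholds/{ExpWordCalculus,WilsonHessian}.lean`.

## References
* M. García Pérez, A. González-Arroyo, M. Okawa, *Perturbative contributions to Wilson loops in twisted lattice
  boxes and reduced models*, JHEP 10 (2017) 150 = arXiv:1708.00841, §2.2–§2.3, eq. (2.3) and the displays for
  `A'_ν`, `G_{μν}` (corpus `paper:arxiv-1708.00841` p0006 L11–L29). [GarciaperezGonzalezarroyoOkawa2017]
* M. García Pérez, A. González-Arroyo, M. Okawa, IJMPA 29 (2014) 1445001 = arXiv:1406.5655, §3. [GarciaperezGonzalezarroyoOkawa2014]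
* H. Shen, R. Zhu, X. Zhu, *A stochastic analysis approach to lattice Yang–Mills at strong coupling*, CMP 400
  (2023) 805, Lemma 4.1 and its proof, (4.3) (corpus `paper:arxiv-2204.12737` p0013). [ShenZhuZhuCMP2023]
-/

noncomputable section

open scoped Matrix
open Finset NormedSpace

namespace Literature.MathematicalPhysics.QuantumLattice

namespace WilsonSecondVariation

variable {n : Type*} [Fintype n] [DecidableEq n]

/-! ## §1 Exponential words `B₀ e^{tV₁} B₁ e^{tV₂} B₂ e^{tV₃} B₃ e^{tV₄} B₄` and their derivatives -/

/-- The exponentially perturbed word `B₀ e^{tV₁} B₁ e^{tV₂} B₂ e^{tV₃} B₃ e^{tV₄} B₄` (matrix exponential).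
[cite: ShenZhuZhuCMP2023, Lemma 4.1 proof (4.3): «effectively just inserting the matrix»] -/
def word (B₀ V₁ B₁ V₂ B₂ V₃ B₃ V₄ B₄ : Matrix n n ℂ) (t : ℝ) : Matrix n n ℂ :=
  B₀ * exp (t • V₁) * B₁ * exp (t • V₂) * B₂ * exp (t • V₃) * B₃ * exp (t • V₄) * B₄

/-- At `t = 0` the word is the product of its constants. [cite: ShenZhuZhuCMP2023, Lemma 4.1 proof] -/
theorem word_zero (B₀ V₁ B₁ V₂ B₂ V₃ B₃ V₄ B₄ : Matrix n n ℂ) :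
    word B₀ V₁ B₁ V₂ B₂ V₃ B₃ V₄ B₄ 0 = B₀ * B₁ * B₂ * B₃ * B₄ := by
  simp only [word, zero_smul, NormedSpace.exp_zero, Matrix.mul_one]

section Calculus

-- The analytic facts about `exp` live in the scoped `L∞`-operator normed algebra structure on
-- matrices (as in Mathlib's `MatrixExponential.lean` and the tree's `Literature/Analysis/Matrix/DetExp.lean`).
set_option backward.isDefEq.respectTransparency false

open scoped Matrix.Norms.Operator

/-- **Product rule for the word**: `d/dt word` is the sum of the four words in which the constant in front
of `e^{tV_i}` is multiplied on the right by `V_i` (`d/dt e^{tV} = V e^{tV}`).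
[cite: ShenZhuZhuCMP2023, Lemma 4.1 proof (e:X3Q): derivatives of plaquette words by insertion] -/
theorem hasDerivAt_word (B₀ V₁ B₁ V₂ B₂ V₃ B₃ V₄ B₄ : Matrix n n ℂ) (t : ℝ) :
    HasDerivAt (word B₀ V₁ B₁ V₂ B₂ V₃ B₃ V₄ B₄)
      (word (B₀ * V₁) V₁ B₁ V₂ B₂ V₃ B₃ V₄ B₄ t + word B₀ V₁ (B₁ * V₂) V₂ B₂ V₃ B₃ V₄ B₄ t
        + word B₀ V₁ B₁ V₂ (B₂ * V₃) V₃ B₃ V₄ B₄ t + word B₀ V₁ B₁ V₂ B₂ V₃ (B₃ * V₄) V₄ B₄ t) t := by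
  have e₁ := hasDerivAt_exp_smul_const' (𝕂 := ℝ) V₁ t
  have e₂ := hasDerivAt_exp_smul_const' (𝕂 := ℝ) V₂ t
  have e₃ := hasDerivAt_exp_smul_const' (𝕂 := ℝ) V₃ t
  have e₄ := hasDerivAt_exp_smul_const' (𝕂 := ℝ) V₄ t
  have h := (((((((e₁.const_mul B₀).mul_const B₁).fun_mul e₂).mul_const B₂).fun_mul e₃).mul_const
    B₃).fun_mul e₄).mul_const B₄
  refine h.congr_deriv ?_
  simp only [word, Matrix.add_mul, Matrix.mul_assoc]

/-- `Re tr` as a continuous `ℝ`-linear functional (finite dimension; norm-independent as a function). [folklore] -/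
private def reTr : Matrix n n ℂ →L[ℝ] ℝ :=
  LinearMap.toContinuousLinearMap
    { toFun := fun M => M.trace.re
      map_add' := fun A B => by simp [Matrix.trace_add]
      map_smul' := fun r A => by simp [Matrix.trace_smul] }

omit [DecidableEq n] in
/-- Chain rule through `Re tr`. [folklore] -/
private theorem hasDerivAt_reTr {W : ℝ → Matrix n n ℂ} {W' : Matrix n n ℂ} {t : ℝ}
    (h : HasDerivAt W W' t) : HasDerivAt (fun s => (W s).trace.re) W'.trace.re t :=
  HasFDerivAt.comp_hasDerivAt t (reTr (n := n)).hasFDerivAt h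

/-- First derivative of `Re tr(word)`. [cite: ShenZhuZhuCMP2023, Lemma 4.1 proof] -/
theorem hasDerivAt_re_trace_word (B₀ V₁ B₁ V₂ B₂ V₃ B₃ V₄ B₄ : Matrix n n ℂ) (t : ℝ) :
    HasDerivAt (fun s => (word B₀ V₁ B₁ V₂ B₂ V₃ B₃ V₄ B₄ s).trace.re)
      ((word (B₀ * V₁) V₁ B₁ V₂ B₂ V₃ B₃ V₄ B₄ t).trace.re + (word B₀ V₁ (B₁ * V₂) V₂ B₂ V₃ B₃ V₄ B₄ t).trace.re
        + (word B₀ V₁ B₁ V₂ (B₂ * V₃) V₃ B₃ V₄ B₄ t).trace.re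
        + (word B₀ V₁ B₁ V₂ B₂ V₃ (B₃ * V₄) V₄ B₄ t).trace.re) t := by
  have h := hasDerivAt_reTr (hasDerivAt_word B₀ V₁ B₁ V₂ B₂ V₃ B₃ V₄ B₄ t)
  refine h.congr_deriv ?_
  simp only [Matrix.trace_add, Complex.add_re]

end Calculus

/-! ## §2 The pure exponential word `e^{tY₁}e^{tY₂}e^{tY₃}e^{tY₄}`: first and second variation at `t = 0` -/

/-- `F_Y(t) = e^{tY₁} e^{tY₂} e^{tY₃} e^{tY₄}`. [cite: GarciaperezGonzalezarroyoOkawa2017, §2.3 (2.3) (the plaquette as a product of four exponentials after transport)] -/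
def expWord4 (Y₁ Y₂ Y₃ Y₄ : Matrix n n ℂ) (t : ℝ) : Matrix n n ℂ :=
  exp (t • Y₁) * exp (t • Y₂) * exp (t • Y₃) * exp (t • Y₄)

/-- The pure word is the general word with unit constants. [cite: ShenZhuZhuCMP2023, Lemma 4.1 proof (words with insertions `Y_i = I_N`)] -/
theorem expWord4_eq_word (Y₁ Y₂ Y₃ Y₄ : Matrix n n ℂ) :
    expWord4 Y₁ Y₂ Y₃ Y₄ = word 1 Y₁ 1 Y₂ 1 Y₃ 1 Y₄ 1 := by
  funext t; simp only [expWord4, word, Matrix.one_mul, Matrix.mul_one]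

/-- The first-variation function of `Re tr F_Y`: the sum of the four insertion words.
[cite: ShenZhuZhuCMP2023, Lemma 4.1 proof, (e:X3Q) (first derivatives by insertion)] -/
def firstVar (Y₁ Y₂ Y₃ Y₄ : Matrix n n ℂ) (t : ℝ) : ℝ :=
  (word Y₁ Y₁ 1 Y₂ 1 Y₃ 1 Y₄ 1 t).trace.re + (word 1 Y₁ Y₂ Y₂ 1 Y₃ 1 Y₄ 1 t).trace.re
    + (word 1 Y₁ 1 Y₂ Y₃ Y₃ 1 Y₄ 1 t).trace.re + (word 1 Y₁ 1 Y₂ 1 Y₃ Y₄ Y₄ 1 t).trace.re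

/-- `d/dt Re tr F_Y(t) = firstVar Y t` at every `t`. [cite: ShenZhuZhuCMP2023, Lemma 4.1 proof] -/
theorem hasDerivAt_re_trace_expWord4 (Y₁ Y₂ Y₃ Y₄ : Matrix n n ℂ) (t : ℝ) :
    HasDerivAt (fun s => (expWord4 Y₁ Y₂ Y₃ Y₄ s).trace.re) (firstVar Y₁ Y₂ Y₃ Y₄ t) t := by
  have h := hasDerivAt_re_trace_word 1 Y₁ 1 Y₂ 1 Y₃ 1 Y₄ 1 t
  rw [expWord4_eq_word]
  refine h.congr_deriv ?_
  simp only [firstVar, Matrix.one_mul]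

/-- **First variation at `t = 0`**: `d/dt|₀ Re tr(e^{tY₁}e^{tY₂}e^{tY₃}e^{tY₄}) = Re tr(Y₁ + Y₂ + Y₃ + Y₄)`.
[cite: ShenZhuZhuCMP2023, Lemma 4.1 proof (e:X3Q)] -/
theorem firstVar_zero (Y₁ Y₂ Y₃ Y₄ : Matrix n n ℂ) :
    firstVar Y₁ Y₂ Y₃ Y₄ 0 = (Y₁ + Y₂ + Y₃ + Y₄).trace.re := by
  simp only [firstVar, word_zero, Matrix.one_mul, Matrix.mul_one, Matrix.trace_add, Complex.add_re]

/-- **Second variation at `t = 0`**: the derivative at `0` of the first variation of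
`Re tr(e^{tY₁}e^{tY₂}e^{tY₃}e^{tY₄})` is `Re tr((Y₁ + Y₂ + Y₃ + Y₄)²)` — the 16 ordered insertions
`(i, k)` give `Σ_i Y_i² + 2Σ_{i<k} Y_iY_k`, whose trace is that of the square by cyclicity.
[cite: ShenZhuZhuCMP2023, Lemma 4.1 proof, cases (1) `e = ē` and (2) `e ≠ ē`] -/
theorem hasDerivAt_firstVar_zero (Y₁ Y₂ Y₃ Y₄ : Matrix n n ℂ) :
    HasDerivAt (firstVar Y₁ Y₂ Y₃ Y₄)
      (((Y₁ + Y₂ + Y₃ + Y₄) * (Y₁ + Y₂ + Y₃ + Y₄)).trace.re) 0 := by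
  have h₁ := hasDerivAt_re_trace_word Y₁ Y₁ 1 Y₂ 1 Y₃ 1 Y₄ 1 0
  have h₂ := hasDerivAt_re_trace_word 1 Y₁ Y₂ Y₂ 1 Y₃ 1 Y₄ 1 0
  have h₃ := hasDerivAt_re_trace_word 1 Y₁ 1 Y₂ Y₃ Y₃ 1 Y₄ 1 0
  have h₄ := hasDerivAt_re_trace_word 1 Y₁ 1 Y₂ 1 Y₃ Y₄ Y₄ 1 0
  have h := ((h₁.add h₂).add h₃).add h₄
  refine h.congr_deriv ?_
  simp only [word_zero, Matrix.one_mul, Matrix.mul_one, Matrix.add_mul, Matrix.mul_add, Matrix.trace_add,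
    Complex.add_re]
  rw [Matrix.trace_mul_comm Y₂ Y₁, Matrix.trace_mul_comm Y₃ Y₁, Matrix.trace_mul_comm Y₄ Y₁,
    Matrix.trace_mul_comm Y₃ Y₂, Matrix.trace_mul_comm Y₄ Y₂, Matrix.trace_mul_comm Y₄ Y₃]

/-- Packaged: `deriv (Re tr F_Y) = firstVar Y`, `deriv (Re tr F_Y) 0 = Re tr ΣY`,
`iteratedDeriv 2 (Re tr F_Y) 0 = Re tr (ΣY)²`. [cite: ShenZhuZhuCMP2023, (4.3) and Lemma 4.1 proof] -/
theorem iteratedDeriv_two_re_trace_expWord4 (Y₁ Y₂ Y₃ Y₄ : Matrix n n ℂ) :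
    iteratedDeriv 2 (fun s => (expWord4 Y₁ Y₂ Y₃ Y₄ s).trace.re) 0 =
      ((Y₁ + Y₂ + Y₃ + Y₄) * (Y₁ + Y₂ + Y₃ + Y₄)).trace.re := by
  have hd : deriv (fun s => (expWord4 Y₁ Y₂ Y₃ Y₄ s).trace.re) = firstVar Y₁ Y₂ Y₃ Y₄ :=
    funext fun t => (hasDerivAt_re_trace_expWord4 Y₁ Y₂ Y₃ Y₄ t).deriv
  rw [iteratedDeriv_succ, iteratedDeriv_one, hd]
  exact (hasDerivAt_firstVar_zero Y₁ Y₂ Y₃ Y₄).deriv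

/-- `deriv (Re tr F_Y) 0 = Re tr(Y₁ + Y₂ + Y₃ + Y₄)`. [cite: ShenZhuZhuCMP2023, Lemma 4.1 proof, (e:X3Q)] -/
theorem deriv_re_trace_expWord4_zero (Y₁ Y₂ Y₃ Y₄ : Matrix n n ℂ) :
    deriv (fun s => (expWord4 Y₁ Y₂ Y₃ Y₄ s).trace.re) 0 = (Y₁ + Y₂ + Y₃ + Y₄).trace.re := by
  rw [(hasDerivAt_re_trace_expWord4 Y₁ Y₂ Y₃ Y₄ 0).deriv, firstVar_zero]

/-! ## §3 Skew-Hermitian directions: `Re tr Z = 0` and `Re tr(Z²) = −S(Z)` with `S(Z) = Re tr(Zᴴ Z)` -/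

omit [DecidableEq n] in
/-- `Re tr Z = 0` for skew-Hermitian `Z` (the linear term of the plaquette expansion vanishes for anti-hermitian
vector potentials). [cite: GarciaperezGonzalezarroyoOkawa2017, §2.3 (expansion of the plaquette, no linear term at a zero-action solution)] -/
theorem re_trace_eq_zero_of_skew {Z : Matrix n n ℂ} (hZ : Zᴴ = -Z) : Z.trace.re = 0 := by
  have h : (Zᴴ).trace = star Z.trace := Matrix.trace_conjTranspose Z
  rw [hZ, Matrix.trace_neg, Complex.star_def] at h
  have h2 := congrArg Complex.re h
  rw [Complex.neg_re, Complex.conj_re] at h2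
  linarith

omit [DecidableEq n] in
/-- `Re tr(Z²) = −Re tr(Zᴴ Z) = −S(Z)` for skew-Hermitian `Z`. [cite: GarciaperezGonzalezarroyoOkawa2017, §2.3 (quadratic term of the plaquette expansion, `tr G²` with anti-hermitian `G`)] -/
theorem re_trace_sq_of_skew {Z : Matrix n n ℂ} (hZ : Zᴴ = -Z) :
    (Z * Z).trace.re = -((Zᴴ * Z).trace).re := by
  rw [hZ, Matrix.neg_mul, Matrix.trace_neg, Complex.neg_re, neg_neg]

/-- **Second variation along skew-Hermitian directions**:
`d²/dt²|₀ Re tr(e^{tY₁}e^{tY₂}e^{tY₃}e^{tY₄}) = −S(Y₁ + Y₂ + Y₃ + Y₄)` and the first variation vanishes.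
[cite: ShenZhuZhuCMP2023, (4.3), Lemma 4.1 proof] -/
theorem iteratedDeriv_two_re_trace_expWord4_of_skew {Y₁ Y₂ Y₃ Y₄ : Matrix n n ℂ}
    (h₁ : Y₁ᴴ = -Y₁) (h₂ : Y₂ᴴ = -Y₂) (h₃ : Y₃ᴴ = -Y₃) (h₄ : Y₄ᴴ = -Y₄) :
    iteratedDeriv 2 (fun s => (expWord4 Y₁ Y₂ Y₃ Y₄ s).trace.re) 0 =
      -(((Y₁ + Y₂ + Y₃ + Y₄)ᴴ * (Y₁ + Y₂ + Y₃ + Y₄)).trace).re := by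
  rw [iteratedDeriv_two_re_trace_expWord4]
  refine re_trace_sq_of_skew ?_
  simp only [Matrix.conjTranspose_add, h₁, h₂, h₃, h₄]
  abel

/-- The first variation vanishes along skew-Hermitian directions. [cite: GarciaperezGonzalezarroyoOkawa2017, §2.3] -/
theorem deriv_re_trace_expWord4_zero_of_skew {Y₁ Y₂ Y₃ Y₄ : Matrix n n ℂ}
    (h₁ : Y₁ᴴ = -Y₁) (h₂ : Y₂ᴴ = -Y₂) (h₃ : Y₃ᴴ = -Y₃) (h₄ : Y₄ᴴ = -Y₄) :
    deriv (fun s => (expWord4 Y₁ Y₂ Y₃ Y₄ s).trace.re) 0 = 0 := by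
  rw [deriv_re_trace_expWord4_zero]
  refine re_trace_eq_zero_of_skew ?_
  simp only [Matrix.conjTranspose_add, h₁, h₂, h₃, h₄]
  abel

/-! ## §4 A centre-flat plaquette: transport of the perturbations to the base point
[García Pérez–González-Arroyo–Okawa (2.3)] -/

section Flat

-- `exp` conjugation lemmas are stated through Mathlib's `Matrix.exp_units_conj` / `exp_conjTranspose`.
set_option backward.isDefEq.respectTransparency false

/-- `Γ e^{tX} Γᴴ = e^{t ΓXΓᴴ}` for `ΓᴴΓ = 1`. [folklore] -/
private theorem conj_exp_smul {Γ X : Matrix n n ℂ} (hΓ : Γᴴ * Γ = 1) (t : ℝ) :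
    Γ * exp (t • X) * Γᴴ = exp (t • (Γ * X * Γᴴ)) := by
  have hΓ' : Γ * Γᴴ = 1 := mul_eq_one_comm.1 hΓ
  let u : (Matrix n n ℂ)ˣ := ⟨Γ, Γᴴ, hΓ', hΓ⟩
  have h := Matrix.exp_units_conj u (t • X)
  have hu : (u : Matrix n n ℂ) = Γ := rfl
  have hui : ((u⁻¹ : (Matrix n n ℂ)ˣ) : Matrix n n ℂ) = Γᴴ := rfl
  rw [hu, hui] at h
  rw [← h, Matrix.mul_smul, Matrix.smul_mul]

/-- `(e^{tX})ᴴ = e^{t(−X)}` for real `t` and skew-Hermitian `X`. [folklore] -/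
private theorem conjTranspose_exp_smul {X : Matrix n n ℂ} (hX : Xᴴ = -X) (t : ℝ) :
    (exp (t • X))ᴴ = exp (t • (-X)) := by
  rw [← Matrix.exp_conjTranspose, Matrix.conjTranspose_smul, star_trivial, hX]

/-- The plaquette holonomy of the LEFT-perturbed links `e^{tX_i}Γ_i` in the order
`U₁ U₂ U₃ᴴ U₄ᴴ` of `plaquetteHolonomy` ∕ `wilsonPlaquetteSumAlong` (links `(x,μ), (x+μ̂,ν), (x+ν̂,μ), (x,ν)`):
`hol(t) = (e^{tX₁}Γ₁)(e^{tX₂}Γ₂)(e^{tX₃}Γ₃)ᴴ(e^{tX₄}Γ₄)ᴴ`.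
[cite: GarciaperezGonzalezarroyoOkawa2017, §2.3 (2.3) (`U_μ(n) = e^{−igA_μ(n)}Γ_μ(n)`, plaquette of the perturbed links)] -/
def plaqHol (Γ₁ Γ₂ Γ₃ Γ₄ X₁ X₂ X₃ X₄ : Matrix n n ℂ) (t : ℝ) : Matrix n n ℂ :=
  exp (t • X₁) * Γ₁ * (exp (t • X₂) * Γ₂) * (exp (t • X₃) * Γ₃)ᴴ * (exp (t • X₄) * Γ₄)ᴴ

/-- **Transport to the base point** (GPGAO (2.3)): for unitary links `Γ_i` forming a CENTRE-FLAT
plaquette `Γ₁Γ₂Γ₃ᴴΓ₄ᴴ = z·1` and skew-Hermitian `X₃, X₄`,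
`hol(t) = z · e^{tX₁} e^{tΓ₁X₂Γ₁ᴴ} e^{−tΓ₄X₃Γ₄ᴴ} e^{−tX₄}` — the perturbations parallel-transported to
the base point with the background links («`A'_ν(n+μ̂) = Γ_μ(n)A_ν(n+μ̂)Γ_μ†(n)`»).
[cite: GarciaperezGonzalezarroyoOkawa2017, §2.3 eq. (2.3) and the display defining A'] -/
theorem plaqHol_eq_smul_expWord4 {Γ₁ Γ₂ Γ₃ Γ₄ X₁ X₂ X₃ X₄ : Matrix n n ℂ} {z : ℂ}
    (hΓ₁ : Γ₁ᴴ * Γ₁ = 1) (hΓ₄ : Γ₄ᴴ * Γ₄ = 1) (h₃ : X₃ᴴ = -X₃) (h₄ : X₄ᴴ = -X₄)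
    (hflat : Γ₁ * Γ₂ * Γ₃ᴴ * Γ₄ᴴ = z • (1 : Matrix n n ℂ)) (t : ℝ) :
    plaqHol Γ₁ Γ₂ Γ₃ Γ₄ X₁ X₂ X₃ X₄ t =
      z • expWord4 X₁ (Γ₁ * X₂ * Γ₁ᴴ) (-(Γ₄ * X₃ * Γ₄ᴴ)) (-X₄) t := by
  have e3 : (exp (t • X₃) * Γ₃)ᴴ = Γ₃ᴴ * exp (t • (-X₃)) := by
    rw [Matrix.conjTranspose_mul, conjTranspose_exp_smul h₃]
  have e4 : (exp (t • X₄) * Γ₄)ᴴ = Γ₄ᴴ * exp (t • (-X₄)) := by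
    rw [Matrix.conjTranspose_mul, conjTranspose_exp_smul h₄]
  have hA : Γ₁ * exp (t • X₂) = exp (t • (Γ₁ * X₂ * Γ₁ᴴ)) * Γ₁ := by
    calc Γ₁ * exp (t • X₂) = Γ₁ * exp (t • X₂) * (Γ₁ᴴ * Γ₁) := by rw [hΓ₁, Matrix.mul_one]
      _ = (Γ₁ * exp (t • X₂) * Γ₁ᴴ) * Γ₁ := by simp only [Matrix.mul_assoc]
      _ = exp (t • (Γ₁ * X₂ * Γ₁ᴴ)) * Γ₁ := by rw [conj_exp_smul hΓ₁]
  have hP : Γ₁ * Γ₂ * Γ₃ᴴ = z • Γ₄ := by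
    calc Γ₁ * Γ₂ * Γ₃ᴴ = Γ₁ * Γ₂ * Γ₃ᴴ * (Γ₄ᴴ * Γ₄) := by rw [hΓ₄, Matrix.mul_one]
      _ = (Γ₁ * Γ₂ * Γ₃ᴴ * Γ₄ᴴ) * Γ₄ := by simp only [Matrix.mul_assoc]
      _ = z • Γ₄ := by rw [hflat, Matrix.smul_mul, Matrix.one_mul]
  have hB : Γ₁ * Γ₂ * Γ₃ᴴ * exp (t • (-X₃)) * Γ₄ᴴ = z • exp (t • (-(Γ₄ * X₃ * Γ₄ᴴ))) := by
    rw [hP, Matrix.smul_mul, Matrix.smul_mul, conj_exp_smul hΓ₄, Matrix.mul_neg, Matrix.neg_mul]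
  unfold plaqHol expWord4
  rw [e3, e4]
  calc exp (t • X₁) * Γ₁ * (exp (t • X₂) * Γ₂) * (Γ₃ᴴ * exp (t • (-X₃))) * (Γ₄ᴴ * exp (t • (-X₄)))
      = exp (t • X₁) * (Γ₁ * exp (t • X₂)) * (Γ₂ * Γ₃ᴴ * exp (t • (-X₃)) * Γ₄ᴴ) * exp (t • (-X₄)) := by
        simp only [Matrix.mul_assoc]
    _ = exp (t • X₁) * (exp (t • (Γ₁ * X₂ * Γ₁ᴴ)) * Γ₁) * (Γ₂ * Γ₃ᴴ * exp (t • (-X₃)) * Γ₄ᴴ) *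
          exp (t • (-X₄)) := by rw [hA]
    _ = exp (t • X₁) * exp (t • (Γ₁ * X₂ * Γ₁ᴴ)) * (Γ₁ * Γ₂ * Γ₃ᴴ * exp (t • (-X₃)) * Γ₄ᴴ) *
          exp (t • (-X₄)) := by simp only [Matrix.mul_assoc]
    _ = exp (t • X₁) * exp (t • (Γ₁ * X₂ * Γ₁ᴴ)) * (z • exp (t • (-(Γ₄ * X₃ * Γ₄ᴴ)))) * exp (t • (-X₄)) := by
        rw [hB]
    _ = z • (exp (t • X₁) * exp (t • (Γ₁ * X₂ * Γ₁ᴴ)) * exp (t • (-(Γ₄ * X₃ * Γ₄ᴴ))) * exp (t • (-X₄))) := by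
        rw [Matrix.mul_smul, Matrix.smul_mul]

/-- With the twist phase removed (`|z| = 1`): `z̄ · hol(t) = e^{tX₁} e^{tΓ₁X₂Γ₁ᴴ} e^{−tΓ₄X₃Γ₄ᴴ} e^{−tX₄}`.
[cite: GarciaperezGonzalezarroyoOkawa2017, §2.3 (2.3) (`Z*_{μν}(n) Tr(…) = Tr(e^{−igG_{μν}(n)})`)] -/
theorem star_smul_plaqHol_eq_expWord4 {Γ₁ Γ₂ Γ₃ Γ₄ X₁ X₂ X₃ X₄ : Matrix n n ℂ} {z : ℂ}
    (hΓ₁ : Γ₁ᴴ * Γ₁ = 1) (hΓ₄ : Γ₄ᴴ * Γ₄ = 1) (h₃ : X₃ᴴ = -X₃) (h₄ : X₄ᴴ = -X₄)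
    (hflat : Γ₁ * Γ₂ * Γ₃ᴴ * Γ₄ᴴ = z • (1 : Matrix n n ℂ)) (hz : star z * z = 1) (t : ℝ) :
    star z • plaqHol Γ₁ Γ₂ Γ₃ Γ₄ X₁ X₂ X₃ X₄ t =
      expWord4 X₁ (Γ₁ * X₂ * Γ₁ᴴ) (-(Γ₄ * X₃ * Γ₄ᴴ)) (-X₄) t := by
  rw [plaqHol_eq_smul_expWord4 hΓ₁ hΓ₄ h₃ h₄ hflat, smul_smul, hz, one_smul]

omit [DecidableEq n] in
/-- Conjugates of skew-Hermitian matrices by unitaries are skew-Hermitian. [folklore] -/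
private theorem conj_skew {Γ X : Matrix n n ℂ} (hX : Xᴴ = -X) : (Γ * X * Γᴴ)ᴴ = -(Γ * X * Γᴴ) := by
  rw [Matrix.conjTranspose_mul, Matrix.conjTranspose_mul, Matrix.conjTranspose_conjTranspose, hX,
    Matrix.neg_mul, Matrix.mul_neg, Matrix.mul_assoc]

/-- **Second variation of the Wilson plaquette term at a centre-flat plaquette.**  For unitary
`Γ₁, …, Γ₄` with `Γ₁Γ₂Γ₃ᴴΓ₄ᴴ = z·1`, `|z| = 1`, and skew-Hermitian `X₁, …, X₄` (links `e^{tX_i}Γ_i`):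
`d²/dt²|₀ Re tr(z̄·hol(t)) = −S(X₁ + Γ₁X₂Γ₁ᴴ − Γ₄X₃Γ₄ᴴ − X₄)`, `S(G) = Re tr(GᴴG)` — minus the squared
Hilbert–Schmidt norm of the background-covariant linearised field strength
`G_{μν}(n) = ∇⁺_μX_ν(n) − ∇⁺_νX_μ(n)`, `∇⁺_μX_ν(n) = Γ_μ(n)X_ν(n+μ̂)Γ_μ(n)ᴴ − X_ν(n)`
(for the plaquette `(n;μ,ν)`: `Γ₁ = Γ_μ(n)`, `Γ₄ = Γ_ν(n)`, `X₁ = X_μ(n)`, `X₂ = X_ν(n+μ̂)`, `X₃ = X_μ(n+ν̂)`,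
`X₄ = X_ν(n)`).  [cite: GarciaperezGonzalezarroyoOkawa2017, §2.3: (2.3) and `G_{μν}(n) = ∇_μ⁺A_ν(n) − ∇_ν⁺A_μ(n) + O(g)`]
[cite: ShenZhuZhuCMP2023, Lemma 4.1 proof, (4.3)] -/
theorem iteratedDeriv_two_re_trace_plaqHol {Γ₁ Γ₂ Γ₃ Γ₄ X₁ X₂ X₃ X₄ : Matrix n n ℂ} {z : ℂ}
    (hΓ₁ : Γ₁ᴴ * Γ₁ = 1) (hΓ₄ : Γ₄ᴴ * Γ₄ = 1) (h₁ : X₁ᴴ = -X₁) (h₂ : X₂ᴴ = -X₂) (h₃ : X₃ᴴ = -X₃)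
    (h₄ : X₄ᴴ = -X₄) (hflat : Γ₁ * Γ₂ * Γ₃ᴴ * Γ₄ᴴ = z • (1 : Matrix n n ℂ)) (hz : star z * z = 1) :
    iteratedDeriv 2 (fun t => (star z • plaqHol Γ₁ Γ₂ Γ₃ Γ₄ X₁ X₂ X₃ X₄ t).trace.re) 0 =
      -((((X₁ + Γ₁ * X₂ * Γ₁ᴴ - Γ₄ * X₃ * Γ₄ᴴ - X₄)ᴴ *
          (X₁ + Γ₁ * X₂ * Γ₁ᴴ - Γ₄ * X₃ * Γ₄ᴴ - X₄)).trace).re) := by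
  have hfun : (fun t => (star z • plaqHol Γ₁ Γ₂ Γ₃ Γ₄ X₁ X₂ X₃ X₄ t).trace.re) =
      fun t => (expWord4 X₁ (Γ₁ * X₂ * Γ₁ᴴ) (-(Γ₄ * X₃ * Γ₄ᴴ)) (-X₄) t).trace.re := by
    funext t; rw [star_smul_plaqHol_eq_expWord4 hΓ₁ hΓ₄ h₃ h₄ hflat hz]
  rw [hfun, iteratedDeriv_two_re_trace_expWord4_of_skew h₁ (conj_skew h₂)
    (by rw [Matrix.conjTranspose_neg, conj_skew h₃, neg_neg]) (by rw [Matrix.conjTranspose_neg, h₄, neg_neg])]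
  have hsum : X₁ + Γ₁ * X₂ * Γ₁ᴴ + -(Γ₄ * X₃ * Γ₄ᴴ) + -X₄ = X₁ + Γ₁ * X₂ * Γ₁ᴴ - Γ₄ * X₃ * Γ₄ᴴ - X₄ := by
    abel
  rw [hsum]

/-- The first variation vanishes at a centre-flat plaquette (flat configurations are critical).
[cite: GarciaperezGonzalezarroyoOkawa2017, §2.2–2.3 (zero-action solutions; no linear term)] -/
theorem deriv_re_trace_plaqHol_zero {Γ₁ Γ₂ Γ₃ Γ₄ X₁ X₂ X₃ X₄ : Matrix n n ℂ} {z : ℂ}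
    (hΓ₁ : Γ₁ᴴ * Γ₁ = 1) (hΓ₄ : Γ₄ᴴ * Γ₄ = 1) (h₁ : X₁ᴴ = -X₁) (h₂ : X₂ᴴ = -X₂) (h₃ : X₃ᴴ = -X₃)
    (h₄ : X₄ᴴ = -X₄) (hflat : Γ₁ * Γ₂ * Γ₃ᴴ * Γ₄ᴴ = z • (1 : Matrix n n ℂ)) (hz : star z * z = 1) :
    deriv (fun t => (star z • plaqHol Γ₁ Γ₂ Γ₃ Γ₄ X₁ X₂ X₃ X₄ t).trace.re) 0 = 0 := by
  have hfun : (fun t => (star z • plaqHol Γ₁ Γ₂ Γ₃ Γ₄ X₁ X₂ X₃ X₄ t).trace.re) =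
      fun t => (expWord4 X₁ (Γ₁ * X₂ * Γ₁ᴴ) (-(Γ₄ * X₃ * Γ₄ᴴ)) (-X₄) t).trace.re := by
    funext t; rw [star_smul_plaqHol_eq_expWord4 hΓ₁ hΓ₄ h₃ h₄ hflat hz]
  rw [hfun]
  exact deriv_re_trace_expWord4_zero_of_skew h₁ (conj_skew h₂)
    (by rw [Matrix.conjTranspose_neg, conj_skew h₃, neg_neg]) (by rw [Matrix.conjTranspose_neg, h₄, neg_neg])

/-- At `t = 0` the twist-corrected plaquette term is maximal: `Re tr(z̄·hol(0)) = |n|`.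
[cite: GarciaperezGonzalezarroyoOkawa2017, §2.2 (zero-action configurations)] -/
theorem re_trace_plaqHol_zero {Γ₁ Γ₂ Γ₃ Γ₄ X₁ X₂ X₃ X₄ : Matrix n n ℂ} {z : ℂ}
    (hflat : Γ₁ * Γ₂ * Γ₃ᴴ * Γ₄ᴴ = z • (1 : Matrix n n ℂ)) (hz : star z * z = 1) :
    (star z • plaqHol Γ₁ Γ₂ Γ₃ Γ₄ X₁ X₂ X₃ X₄ 0).trace.re = Fintype.card n := by
  have h0 : plaqHol Γ₁ Γ₂ Γ₃ Γ₄ X₁ X₂ X₃ X₄ 0 = z • (1 : Matrix n n ℂ) := by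
    simp only [plaqHol, zero_smul, NormedSpace.exp_zero, Matrix.one_mul]
    rw [← hflat]
  rw [h0, smul_smul, hz, one_smul, Matrix.trace_one, Complex.natCast_re]


/-! ### Trivial background (`Γ_i = 1`, `z = 1`): the transition-function picture -/

/-- With unit background links the plaquette of `e^{tX_i}` is the pure word `e^{tX₁}e^{tX₂}e^{−tX₃}e^{−tX₄}`.
[cite: GarciaperezGonzalezarroyoOkawa2017, §2.3 (2.3) with `Γ ≡ 1`] -/
theorem plaqHol_one (X₁ X₂ : Matrix n n ℂ) {X₃ X₄ : Matrix n n ℂ} (h₃ : X₃ᴴ = -X₃) (h₄ : X₄ᴴ = -X₄) (t : ℝ) :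
    plaqHol 1 1 1 1 X₁ X₂ X₃ X₄ t = expWord4 X₁ X₂ (-X₃) (-X₄) t := by
  simp only [plaqHol, expWord4, Matrix.mul_one, conjTranspose_exp_smul h₃, conjTranspose_exp_smul h₄]

/-- The plaquette term `c − Re tr plaq(t)` has derivative `−firstVar` everywhere (unit background).
[cite: ShenZhuZhuCMP2023, Lemma 4.1 proof] -/
theorem hasDerivAt_plaqTerm (c : ℝ) (X₁ X₂ : Matrix n n ℂ) {X₃ X₄ : Matrix n n ℂ} (h₃ : X₃ᴴ = -X₃)
    (h₄ : X₄ᴴ = -X₄) (t : ℝ) :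
    HasDerivAt (fun s => c - (plaqHol 1 1 1 1 X₁ X₂ X₃ X₄ s).trace.re) (-firstVar X₁ X₂ (-X₃) (-X₄) t) t := by
  have h := (hasDerivAt_re_trace_expWord4 X₁ X₂ (-X₃) (-X₄) t).const_sub c
  refine h.congr_of_eventuallyEq (Filter.Eventually.of_forall fun s => ?_)
  simp only [plaqHol_one X₁ X₂ h₃ h₄]

omit [Fintype n] [DecidableEq n] in
/-- A signed sum of skew-Hermitian matrices is skew-Hermitian. [folklore] -/
private theorem skew_sum4 {X₁ X₂ X₃ X₄ : Matrix n n ℂ} (h₁ : X₁ᴴ = -X₁) (h₂ : X₂ᴴ = -X₂) (h₃ : X₃ᴴ = -X₃)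
    (h₄ : X₄ᴴ = -X₄) : (X₁ + X₂ + -X₃ + -X₄)ᴴ = -(X₁ + X₂ + -X₃ + -X₄) := by
  simp only [Matrix.conjTranspose_add, Matrix.conjTranspose_neg, h₁, h₂, h₃, h₄]
  abel

/-- At `t = 0` the first variation of a unit-background plaquette term vanishes (skew-Hermitian directions).
[cite: GarciaperezGonzalezarroyoOkawa2017, §2.2–2.3] -/
theorem firstVar_zero_of_skew {X₁ X₂ X₃ X₄ : Matrix n n ℂ} (h₁ : X₁ᴴ = -X₁) (h₂ : X₂ᴴ = -X₂)
    (h₃ : X₃ᴴ = -X₃) (h₄ : X₄ᴴ = -X₄) : firstVar X₁ X₂ (-X₃) (-X₄) 0 = 0 := by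
  rw [firstVar_zero]
  exact re_trace_eq_zero_of_skew (skew_sum4 h₁ h₂ h₃ h₄)

/-- The second variation of the unit-background plaquette term `c − Re tr plaq(t)` at `t = 0` is
`S(X₁ + X₂ − X₃ − X₄)` (derivative of `−firstVar` at `0`). [cite: GarciaperezGonzalezarroyoOkawa2017, §2.3 (quadratic term `½ tr G²`)] -/
theorem hasDerivAt_neg_firstVar_zero_of_skew {X₁ X₂ X₃ X₄ : Matrix n n ℂ} (h₁ : X₁ᴴ = -X₁) (h₂ : X₂ᴴ = -X₂)
    (h₃ : X₃ᴴ = -X₃) (h₄ : X₄ᴴ = -X₄) :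
    HasDerivAt (fun t => -firstVar X₁ X₂ (-X₃) (-X₄) t)
      ((((X₁ + X₂ - X₃ - X₄)ᴴ * (X₁ + X₂ - X₃ - X₄)).trace).re) 0 := by
  have h := (hasDerivAt_firstVar_zero X₁ X₂ (-X₃) (-X₄)).neg
  refine h.congr_deriv ?_
  rw [re_trace_sq_of_skew (skew_sum4 h₁ h₂ h₃ h₄), neg_neg]
  have heq : X₁ + X₂ + -X₃ + -X₄ = X₁ + X₂ - X₃ - X₄ := by abel
  rw [heq]

end Flat

end WilsonSecondVariation

/-! ## §5 Assembly on the twisted torus `ℓ × ℓ` and the twisted slab `ℓ × ℓ × L` (transition-function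
picture of `TwistedTorusOneFormGap.lean`: background links `1`, twist in the boundary condition) -/

section Lattice

open WilsonSecondVariation

variable {N : ℕ}

/-- Congruence for `S(M) = Re tr(MᴴM)`. [folklore] -/
private theorem hsS_congr {M M' : Matrix (Fin N) (Fin N) ℂ} (h : M = M') :
    ((Mᴴ * M).trace).re = ((M'ᴴ * M').trace).re := by rw [h]

/-- The Wilson action of the `ℓ × ℓ` window for the link field `U_μ = e^{t a_μ}` (transition-function picture;
plaquette at `(x,y)` = `U₀(x,y) U₁(x+1,y) U₀(x,y+1)ᴴ U₁(x,y)ᴴ`): `W(t) = Σ_{x,y<ℓ} (N − Re tr plaquette(t))`.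
[cite: GarciaperezGonzalezarroyoOkawa2017, §2.1–2.3 (Wilson action of the twisted box around the zero-action solution)] -/
def windowWilsonAction (a₀ a₁ : ℕ → ℕ → Matrix (Fin N) (Fin N) ℂ) (ℓ : ℕ) (t : ℝ) : ℝ :=
  ∑ x ∈ range ℓ, ∑ y ∈ range ℓ,
    ((N : ℝ) - (plaqHol 1 1 1 1 (a₀ x y) (a₁ (x + 1) y) (a₀ x (y + 1)) (a₁ x y) t).trace.re)

/-- `W(0) = 0`: the twist eater has zero action. [cite: GarciaperezGonzalezarroyoOkawa2017, §2.2] -/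
theorem windowWilsonAction_zero (a₀ a₁ : ℕ → ℕ → Matrix (Fin N) (Fin N) ℂ) (ℓ : ℕ) :
    windowWilsonAction a₀ a₁ ℓ 0 = 0 := by
  simp [windowWilsonAction, plaqHol]

/-- `W'(t)` everywhere, for skew-Hermitian fields. [cite: ShenZhuZhuCMP2023, Lemma 4.1 proof] -/
theorem hasDerivAt_windowWilsonAction {a₀ a₁ : ℕ → ℕ → Matrix (Fin N) (Fin N) ℂ} {ℓ : ℕ}
    (h0 : ∀ x y, (a₀ x y)ᴴ = -a₀ x y) (h1 : ∀ x y, (a₁ x y)ᴴ = -a₁ x y) (t : ℝ) :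
    HasDerivAt (windowWilsonAction a₀ a₁ ℓ)
      (∑ x ∈ range ℓ, ∑ y ∈ range ℓ, -firstVar (a₀ x y) (a₁ (x + 1) y) (-(a₀ x (y + 1))) (-(a₁ x y)) t) t := by
  have h : HasDerivAt (fun s => ∑ x ∈ range ℓ, ∑ y ∈ range ℓ,
      ((N : ℝ) - (plaqHol 1 1 1 1 (a₀ x y) (a₁ (x + 1) y) (a₀ x (y + 1)) (a₁ x y) s).trace.re)) _ t :=
    HasDerivAt.fun_sum fun x _ => HasDerivAt.fun_sum fun y _ =>
      hasDerivAt_plaqTerm (N : ℝ) (a₀ x y) (a₁ (x + 1) y) (h0 x (y + 1)) (h1 x y) t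
  exact h

/-- `W'(0) = 0`: the twist eater is critical. [cite: GarciaperezGonzalezarroyoOkawa2017, §2.2–2.3] -/
theorem deriv_windowWilsonAction_zero {a₀ a₁ : ℕ → ℕ → Matrix (Fin N) (Fin N) ℂ} {ℓ : ℕ}
    (h0 : ∀ x y, (a₀ x y)ᴴ = -a₀ x y) (h1 : ∀ x y, (a₁ x y)ᴴ = -a₁ x y) :
    deriv (windowWilsonAction a₀ a₁ ℓ) 0 = 0 := by
  rw [(hasDerivAt_windowWilsonAction h0 h1 0).deriv]
  refine Finset.sum_eq_zero fun x _ => Finset.sum_eq_zero fun y _ => ?_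
  rw [firstVar_zero_of_skew (h0 x y) (h1 (x + 1) y) (h0 x (y + 1)) (h1 x y), neg_zero]

/-- ★ **The Hessian of the Wilson action at the twist-eating zero-action configuration IS the quadratic form
of `TwistedTorusOneFormGap`**: for skew-Hermitian `a₀, a₁`,
`W''(0) = Σ_{x,y<ℓ} S((a₁(x+1,y) − a₁(x,y)) − (a₀(x,y+1) − a₀(x,y)))` (`S(G) = Re tr(GᴴG)`).
[cite: GarciaperezGonzalezarroyoOkawa2017, §2.3 (`G_{μν} = ∇⁺_μA_ν − ∇⁺_νA_μ + O(g)`; quadratic part of the Wilson action)] -/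
theorem iteratedDeriv_two_windowWilsonAction {a₀ a₁ : ℕ → ℕ → Matrix (Fin N) (Fin N) ℂ} {ℓ : ℕ}
    (h0 : ∀ x y, (a₀ x y)ᴴ = -a₀ x y) (h1 : ∀ x y, (a₁ x y)ᴴ = -a₁ x y) :
    iteratedDeriv 2 (windowWilsonAction a₀ a₁ ℓ) 0 =
      ∑ x ∈ range ℓ, ∑ y ∈ range ℓ,
        ((((a₁ (x + 1) y - a₁ x y) - (a₀ x (y + 1) - a₀ x y))ᴴ *
          ((a₁ (x + 1) y - a₁ x y) - (a₀ x (y + 1) - a₀ x y))).trace).re := by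
  have hderiv : deriv (windowWilsonAction a₀ a₁ ℓ) = fun t =>
      ∑ x ∈ range ℓ, ∑ y ∈ range ℓ, -firstVar (a₀ x y) (a₁ (x + 1) y) (-(a₀ x (y + 1))) (-(a₁ x y)) t :=
    funext fun t => (hasDerivAt_windowWilsonAction h0 h1 t).deriv
  have hd2 : HasDerivAt (fun t => ∑ x ∈ range ℓ, ∑ y ∈ range ℓ,
      -firstVar (a₀ x y) (a₁ (x + 1) y) (-(a₀ x (y + 1))) (-(a₁ x y)) t)
      (∑ x ∈ range ℓ, ∑ y ∈ range ℓ,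
        ((((a₀ x y + a₁ (x + 1) y - a₀ x (y + 1) - a₁ x y)ᴴ *
          (a₀ x y + a₁ (x + 1) y - a₀ x (y + 1) - a₁ x y)).trace).re)) 0 :=
    HasDerivAt.fun_sum fun x _ => HasDerivAt.fun_sum fun y _ =>
      hasDerivAt_neg_firstVar_zero_of_skew (h0 x y) (h1 (x + 1) y) (h0 x (y + 1)) (h1 x y)
  rw [iteratedDeriv_succ, iteratedDeriv_one, hderiv, hd2.deriv]
  refine Finset.sum_congr rfl fun x _ => Finset.sum_congr rfl fun y _ => hsS_congr ?_
  abel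

variable {A B : Matrix (Fin N) (Fin N) ℂ} {ω : ℂ} {ℓ : ℕ} {a₀ a₁ : ℕ → ℕ → Matrix (Fin N) (Fin N) ℂ}

/-- ★★ **Tree-level Hessian gap of the Wilson action on the twisted torus (Coulomb gauge).**  At the
twist-eating zero-action configuration of the `ℓ × ℓ` twisted torus (unitary Weyl pair `AB = ωBA`, `ω` primitive),
along every traceless skew-Hermitian twisted-periodic 1-form `a = (a₀, a₁)` in Coulomb gauge (`∇⁻·a = 0`):
`W''(0) ≥ 4 sin²(π/(Nℓ)) · Σ_{x,y<ℓ} (S(a₀) + S(a₁))` — no zero mode modulo gauge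
(`iteratedDeriv_two_windowWilsonAction` + `twistedTorus_oneForm_gap_of_div_eq_zero`).
[cite: GarciaperezGonzalezarroyoOkawa2017, §2.2 («the irreducibility condition eliminates the presence of zero-modes»), §2.3, §2.5]
[cite: GarciaperezGonzalezarroyoOkawa2014, §3] -/
theorem windowWilsonAction_hessian_gap [NeZero N] (hAu : A ∈ Matrix.unitaryGroup (Fin N) ℂ)
    (hBu : B ∈ Matrix.unitaryGroup (Fin N) ℂ) (hω : IsPrimitiveRoot ω N) (hAB : A * B = ω • (B * A))
    (h00 : ∀ x y, a₀ (x + ℓ) y = A * a₀ x y * Aᴴ) (h01 : ∀ x y, a₀ x (y + ℓ) = B * a₀ x y * Bᴴ)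
    (h10 : ∀ x y, a₁ (x + ℓ) y = A * a₁ x y * Aᴴ) (h11 : ∀ x y, a₁ x (y + ℓ) = B * a₁ x y * Bᴴ)
    (hs0 : ∀ x y, (a₀ x y)ᴴ = -a₀ x y) (hs1 : ∀ x y, (a₁ x y)ᴴ = -a₁ x y)
    (htr0 : ∀ x y, (a₀ x y).trace = 0) (htr1 : ∀ x y, (a₁ x y).trace = 0)
    (hdiv : ∀ x y, (a₀ (x + 1) (y + 1) - a₀ x (y + 1)) + (a₁ (x + 1) (y + 1) - a₁ (x + 1) y) = 0) :
    4 * Real.sin (Real.pi / ((N : ℝ) * ℓ)) ^ 2 *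
        ∑ x ∈ range ℓ, ∑ y ∈ range ℓ, ((((a₀ x y)ᴴ * a₀ x y).trace).re + (((a₁ x y)ᴴ * a₁ x y).trace).re) ≤
      iteratedDeriv 2 (windowWilsonAction a₀ a₁ ℓ) 0 := by
  rw [iteratedDeriv_two_windowWilsonAction hs0 hs1]
  exact twistedTorus_oneForm_gap_of_div_eq_zero hAu hBu hω hAB h00 h01 h10 h11 htr0 htr1 hdiv

/-! ### The twisted slab `ℓ × ℓ × L` -/

/-- The Wilson action of the `ℓ × ℓ × L` window (three link fields `U_μ = e^{t a_μ}`, three plaquette orientations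
`(0,1), (0,2), (1,2)` at every site). [cite: GarciaperezGonzalezarroyoOkawa2017, §2.1–2.3] -/
def slabWindowWilsonAction (a₀ a₁ a₂ : ℕ → ℕ → ℕ → Matrix (Fin N) (Fin N) ℂ) (ℓ L : ℕ) (t : ℝ) : ℝ :=
  ∑ x ∈ range ℓ, ∑ y ∈ range ℓ, ∑ u ∈ range L,
    (((N : ℝ) - (plaqHol 1 1 1 1 (a₀ x y u) (a₁ (x + 1) y u) (a₀ x (y + 1) u) (a₁ x y u) t).trace.re) +
      ((N : ℝ) - (plaqHol 1 1 1 1 (a₀ x y u) (a₂ (x + 1) y u) (a₀ x y (u + 1)) (a₂ x y u) t).trace.re) +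
      ((N : ℝ) - (plaqHol 1 1 1 1 (a₁ x y u) (a₂ x (y + 1) u) (a₁ x y (u + 1)) (a₂ x y u) t).trace.re))

/-- `W'(t)` everywhere on the slab, skew-Hermitian fields. [cite: ShenZhuZhuCMP2023, Lemma 4.1 proof] -/
theorem hasDerivAt_slabWindowWilsonAction {a₀ a₁ a₂ : ℕ → ℕ → ℕ → Matrix (Fin N) (Fin N) ℂ} {ℓ L : ℕ}
    (h0 : ∀ x y u, (a₀ x y u)ᴴ = -a₀ x y u) (h1 : ∀ x y u, (a₁ x y u)ᴴ = -a₁ x y u)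
    (h2 : ∀ x y u, (a₂ x y u)ᴴ = -a₂ x y u) (t : ℝ) :
    HasDerivAt (slabWindowWilsonAction a₀ a₁ a₂ ℓ L)
      (∑ x ∈ range ℓ, ∑ y ∈ range ℓ, ∑ u ∈ range L,
        (-firstVar (a₀ x y u) (a₁ (x + 1) y u) (-(a₀ x (y + 1) u)) (-(a₁ x y u)) t +
          -firstVar (a₀ x y u) (a₂ (x + 1) y u) (-(a₀ x y (u + 1))) (-(a₂ x y u)) t +
          -firstVar (a₁ x y u) (a₂ x (y + 1) u) (-(a₁ x y (u + 1))) (-(a₂ x y u)) t)) t := by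
  have h : HasDerivAt (fun s => ∑ x ∈ range ℓ, ∑ y ∈ range ℓ, ∑ u ∈ range L,
      (((N : ℝ) - (plaqHol 1 1 1 1 (a₀ x y u) (a₁ (x + 1) y u) (a₀ x (y + 1) u) (a₁ x y u) s).trace.re) +
        ((N : ℝ) - (plaqHol 1 1 1 1 (a₀ x y u) (a₂ (x + 1) y u) (a₀ x y (u + 1)) (a₂ x y u) s).trace.re) +
        ((N : ℝ) - (plaqHol 1 1 1 1 (a₁ x y u) (a₂ x (y + 1) u) (a₁ x y (u + 1)) (a₂ x y u) s).trace.re))) _ t :=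
    HasDerivAt.fun_sum fun x _ => HasDerivAt.fun_sum fun y _ => HasDerivAt.fun_sum fun u _ =>
      ((hasDerivAt_plaqTerm (N : ℝ) (a₀ x y u) (a₁ (x + 1) y u) (h0 x (y + 1) u) (h1 x y u) t).add
        (hasDerivAt_plaqTerm (N : ℝ) (a₀ x y u) (a₂ (x + 1) y u) (h0 x y (u + 1)) (h2 x y u) t)).add
        (hasDerivAt_plaqTerm (N : ℝ) (a₁ x y u) (a₂ x (y + 1) u) (h1 x y (u + 1)) (h2 x y u) t)
  exact h

/-- ★ **Hessian of the slab Wilson action at the twist eater = the three-orientation curl form of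
`twistedSlab_oneForm_weitzenboeck`.** [cite: GarciaperezGonzalezarroyoOkawa2017, §2.3] -/
theorem iteratedDeriv_two_slabWindowWilsonAction {a₀ a₁ a₂ : ℕ → ℕ → ℕ → Matrix (Fin N) (Fin N) ℂ} {ℓ L : ℕ}
    (h0 : ∀ x y u, (a₀ x y u)ᴴ = -a₀ x y u) (h1 : ∀ x y u, (a₁ x y u)ᴴ = -a₁ x y u)
    (h2 : ∀ x y u, (a₂ x y u)ᴴ = -a₂ x y u) :
    iteratedDeriv 2 (slabWindowWilsonAction a₀ a₁ a₂ ℓ L) 0 =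
      ∑ x ∈ range ℓ, ∑ y ∈ range ℓ, ∑ u ∈ range L,
        (((((a₁ (x + 1) y u - a₁ x y u) - (a₀ x (y + 1) u - a₀ x y u))ᴴ *
            ((a₁ (x + 1) y u - a₁ x y u) - (a₀ x (y + 1) u - a₀ x y u))).trace).re +
          ((((a₂ (x + 1) y u - a₂ x y u) - (a₀ x y (u + 1) - a₀ x y u))ᴴ *
            ((a₂ (x + 1) y u - a₂ x y u) - (a₀ x y (u + 1) - a₀ x y u))).trace).re +
          ((((a₂ x (y + 1) u - a₂ x y u) - (a₁ x y (u + 1) - a₁ x y u))ᴴ *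
            ((a₂ x (y + 1) u - a₂ x y u) - (a₁ x y (u + 1) - a₁ x y u))).trace).re) := by
  have hderiv : deriv (slabWindowWilsonAction a₀ a₁ a₂ ℓ L) = fun t =>
      ∑ x ∈ range ℓ, ∑ y ∈ range ℓ, ∑ u ∈ range L,
        (-firstVar (a₀ x y u) (a₁ (x + 1) y u) (-(a₀ x (y + 1) u)) (-(a₁ x y u)) t +
          -firstVar (a₀ x y u) (a₂ (x + 1) y u) (-(a₀ x y (u + 1))) (-(a₂ x y u)) t +
          -firstVar (a₁ x y u) (a₂ x (y + 1) u) (-(a₁ x y (u + 1))) (-(a₂ x y u)) t) :=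
    funext fun t => (hasDerivAt_slabWindowWilsonAction h0 h1 h2 t).deriv
  have hd2 : HasDerivAt (fun t => ∑ x ∈ range ℓ, ∑ y ∈ range ℓ, ∑ u ∈ range L,
        (-firstVar (a₀ x y u) (a₁ (x + 1) y u) (-(a₀ x (y + 1) u)) (-(a₁ x y u)) t +
          -firstVar (a₀ x y u) (a₂ (x + 1) y u) (-(a₀ x y (u + 1))) (-(a₂ x y u)) t +
          -firstVar (a₁ x y u) (a₂ x (y + 1) u) (-(a₁ x y (u + 1))) (-(a₂ x y u)) t))
      (∑ x ∈ range ℓ, ∑ y ∈ range ℓ, ∑ u ∈ range L,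
        ((((a₀ x y u + a₁ (x + 1) y u - a₀ x (y + 1) u - a₁ x y u)ᴴ *
            (a₀ x y u + a₁ (x + 1) y u - a₀ x (y + 1) u - a₁ x y u)).trace).re +
          (((a₀ x y u + a₂ (x + 1) y u - a₀ x y (u + 1) - a₂ x y u)ᴴ *
            (a₀ x y u + a₂ (x + 1) y u - a₀ x y (u + 1) - a₂ x y u)).trace).re +
          (((a₁ x y u + a₂ x (y + 1) u - a₁ x y (u + 1) - a₂ x y u)ᴴ *
            (a₁ x y u + a₂ x (y + 1) u - a₁ x y (u + 1) - a₂ x y u)).trace).re)) 0 :=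
    HasDerivAt.fun_sum fun x _ => HasDerivAt.fun_sum fun y _ => HasDerivAt.fun_sum fun u _ =>
      ((hasDerivAt_neg_firstVar_zero_of_skew (h0 x y u) (h1 (x + 1) y u) (h0 x (y + 1) u) (h1 x y u)).add
        (hasDerivAt_neg_firstVar_zero_of_skew (h0 x y u) (h2 (x + 1) y u) (h0 x y (u + 1)) (h2 x y u))).add
        (hasDerivAt_neg_firstVar_zero_of_skew (h1 x y u) (h2 x (y + 1) u) (h1 x y (u + 1)) (h2 x y u))
  rw [iteratedDeriv_succ, iteratedDeriv_one, hderiv, hd2.deriv]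
  refine Finset.sum_congr rfl fun x _ => Finset.sum_congr rfl fun y _ => Finset.sum_congr rfl fun u _ => ?_
  rw [hsS_congr (M := a₀ x y u + a₁ (x + 1) y u - a₀ x (y + 1) u - a₁ x y u)
      (M' := (a₁ (x + 1) y u - a₁ x y u) - (a₀ x (y + 1) u - a₀ x y u)) (by abel),
    hsS_congr (M := a₀ x y u + a₂ (x + 1) y u - a₀ x y (u + 1) - a₂ x y u)
      (M' := (a₂ (x + 1) y u - a₂ x y u) - (a₀ x y (u + 1) - a₀ x y u)) (by abel),
    hsS_congr (M := a₁ x y u + a₂ x (y + 1) u - a₁ x y (u + 1) - a₂ x y u)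
      (M' := (a₂ x (y + 1) u - a₂ x y u) - (a₁ x y (u + 1) - a₁ x y u)) (by abel)]

variable {L : ℕ} {b₀ b₁ b₂ : ℕ → ℕ → ℕ → Matrix (Fin N) (Fin N) ℂ}

/-- ★★ **Tree-level Hessian gap of the Wilson action on the twisted slab, Coulomb gauge, UNIFORM in `L`.**
At the twist-eating zero-action configuration of the `ℓ × ℓ × L` slab (twist in the `(0,1)` plane, third
direction periodic of any length `L`), along every traceless skew-Hermitian 1-form `b = (b₀, b₁, b₂)` with the
twisted/periodic boundary conditions and `∇⁻·b = 0`: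
`W''(0) ≥ 4 sin²(π/(Nℓ)) · Σ (S(b₀) + S(b₁) + S(b₂))`.
[cite: GarciaperezGonzalezarroyoOkawa2017, §2.2, §2.3, §2.5] [cite: GarciaperezGonzalezarroyoOkawa2014, §3] -/
theorem slabWindowWilsonAction_hessian_gap [NeZero N] (hAu : A ∈ Matrix.unitaryGroup (Fin N) ℂ)
    (hBu : B ∈ Matrix.unitaryGroup (Fin N) ℂ) (hω : IsPrimitiveRoot ω N) (hAB : A * B = ω • (B * A))
    (h0A : ∀ x y u, b₀ (x + ℓ) y u = A * b₀ x y u * Aᴴ) (h0B : ∀ x y u, b₀ x (y + ℓ) u = B * b₀ x y u * Bᴴ)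
    (h0L : ∀ x y u, b₀ x y (u + L) = b₀ x y u)
    (h1A : ∀ x y u, b₁ (x + ℓ) y u = A * b₁ x y u * Aᴴ) (h1B : ∀ x y u, b₁ x (y + ℓ) u = B * b₁ x y u * Bᴴ)
    (h1L : ∀ x y u, b₁ x y (u + L) = b₁ x y u)
    (h2A : ∀ x y u, b₂ (x + ℓ) y u = A * b₂ x y u * Aᴴ) (h2B : ∀ x y u, b₂ x (y + ℓ) u = B * b₂ x y u * Bᴴ)
    (h2L : ∀ x y u, b₂ x y (u + L) = b₂ x y u)
    (hs0 : ∀ x y u, (b₀ x y u)ᴴ = -b₀ x y u) (hs1 : ∀ x y u, (b₁ x y u)ᴴ = -b₁ x y u)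
    (hs2 : ∀ x y u, (b₂ x y u)ᴴ = -b₂ x y u)
    (htr0 : ∀ x y u, (b₀ x y u).trace = 0) (htr1 : ∀ x y u, (b₁ x y u).trace = 0)
    (htr2 : ∀ x y u, (b₂ x y u).trace = 0)
    (hdiv : ∀ x y u, (b₀ (x + 1) (y + 1) (u + 1) - b₀ x (y + 1) (u + 1)) +
      (b₁ (x + 1) (y + 1) (u + 1) - b₁ (x + 1) y (u + 1)) + (b₂ (x + 1) (y + 1) (u + 1) - b₂ (x + 1) (y + 1) u) = 0) :
    4 * Real.sin (Real.pi / ((N : ℝ) * ℓ)) ^ 2 *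
        ∑ x ∈ range ℓ, ∑ y ∈ range ℓ, ∑ u ∈ range L,
          ((((b₀ x y u)ᴴ * b₀ x y u).trace).re + (((b₁ x y u)ᴴ * b₁ x y u).trace).re +
            (((b₂ x y u)ᴴ * b₂ x y u).trace).re) ≤
      iteratedDeriv 2 (slabWindowWilsonAction b₀ b₁ b₂ ℓ L) 0 := by
  rw [iteratedDeriv_two_slabWindowWilsonAction hs0 hs1 hs2]
  exact twistedSlab_oneForm_gap_of_div_eq_zero hAu hBu hω hAB h0A h0B h0L h1A h1B h1L h2A h2B h2L htr0 htr1 htr2 hdiv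

end Lattice

end Literature.MathematicalPhysics.QuantumLattice
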